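import Summits.AtomisticToContinuum.Crystallization.Theorems.ChartedPlanarOrderPatternPairGeometry

/-!
# ChartedPlanarOrder — the clean-environment interface (`CleanEnvironment`)

decomp-a2c lens-3 (generation 23/24; N = `Theses.ChartedPlanarOrder.ChartedZeroExcessLayered`, PS column).
Fourth building block for the stacked-layer dichotomy (α) `StackedDichotomy`.  An atom `q` of a set `Y` is
`(ε, aLo, aHi)`-two-shell-good (`IsTwoShellGoodSet`, the literal of N's cleanliness binders `IsClean` /
`IsCleanP`) when, after unpacking, there are a scale `a'`, a linear isometry `A`, a pattern
`P ∈ {fccTwoShellPattern, hcpTwoShellPattern}` and a labelling `f` with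
`hm : ∀ v ∈ P, f v ∈ Y ∧ dist (f v) (q + a' • A v) ≤ ε * a'` (every site is occupied, `ε a'`-closely) and
`hc : ∀ y ∈ Y, y ≠ q → dist y q ≤ 3/2 * a' → ∃ v ∈ P, f v = y` (completeness out to `3a'/2`).
This file turns `(hm, hc)` into the statements the dichotomy proof consumes:

* §1 `exists_match` — an atom `y ≠ q` within `3a'/2` is `f v` for a table vector `v` with `‖(y − q) − a' A v‖ ≤ ε a'`.
* §2 `abs_norm_sub_le`, `norm_eq_one_of_short` — `|‖x‖ − a'‖v‖| ≤ ε a'`; a matched offset of length `≤ 17/16`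
  (`a' ≥ 9/10`, `ε = 1/16`) sits on the FIRST shell (`‖v‖ = 1`).
* §3 `norm_add_le_of_antipodal`, `eq_neg_of_antipodal` — offsets `x, −x` are matched to `v, −v` EXACTLY
  (`‖v + v'‖ ≤ 2ε < 1/2` and `ChartedPlanarOrderPatternPairGeometry.add_eq_zero_of_norm_add_lt_half`; recall the hcp
  table is NOT antipodally 1-separated, only `1/√3`-separated, so the smallness `2ε < 1/2` is what is used).
* §4 `abs_inner_sub_le`, `abs_inner_sub_le_unit` — `|⟪x, x'⟫ − a'² ⟪v, v'⟫| ≤ (33/256) a'²` for first-shell matches.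
* §4b `one_le_dist_of_mem_twoShellPattern`, `le_norm_of_match`, ★ `eq_of_near` (LOCAL SEPARATION: two atoms of
  `Y ∖ {q}` within `3a'/2` of `q` at mutual distance `< (1 − 2ε) a'` coincide — the environment is a local chart),
  `scale_le_of_common_length` (two scales fitting one length to relative accuracy `1/16` differ by a factor `≤ 17/15`).
* §5 ★ `period_match`, `periods_distinct`, ★★ `periods_type` — at an atom `q` with `q ± a, q ± b ∈ Y`,
  `‖a‖, ‖b‖ ≤ 17/16`, `a ≠ ±b`, `a, b ≠ 0`: the periods are matched to an antipodally closed first-shell pair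
  `p₁ ≠ ±p₂` of the table, `|‖a‖ − a'|, |‖b‖ − a'| ≤ a'/16`, and (TYPE) `⟪p₁,p₂⟫ = ±1/2` (T: triangular
  period lattice, `|⟪a,b⟫ ∓ a'²/2| ≤ (33/256) a'²`) or `⟪p₁,p₂⟫ = 0 ∧ P = fcc` (S: square, `|⟪a,b⟫| ≤ (33/256) a'²`).
-/

open scoped RealInnerProductSpace
open Literature.Geometry.DiscreteGeometry
open Summit.AtomisticToContinuum.Crystallization.Theorems.ChartedPlanarOrderPatternPairGeometry

namespace Summit.AtomisticToContinuum.Crystallization.Theorems.ChartedPlanarOrderCleanEnvironment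

variable {Y : Set (EuclideanSpace ℝ (Fin 3))} {q : EuclideanSpace ℝ (Fin 3)} {ε a' : ℝ}
  {A : EuclideanSpace ℝ (Fin 3) →ₗᵢ[ℝ] EuclideanSpace ℝ (Fin 3)} {P : Finset (EuclideanSpace ℝ (Fin 3))}
  {f : EuclideanSpace ℝ (Fin 3) → EuclideanSpace ℝ (Fin 3)}

/-! ## §1 Matching -/

/-- an atom `y ≠ q` within `3a'/2` of `q` is the image of a table vector, `ε a'`-close to its site. -/
theorem exists_match (hm : ∀ v ∈ P, f v ∈ Y ∧ dist (f v) (q + a' • A v) ≤ ε * a')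
    (hc : ∀ y ∈ Y, y ≠ q → dist y q ≤ 3 / 2 * a' → ∃ v ∈ P, f v = y)
    {y : EuclideanSpace ℝ (Fin 3)} (hy : y ∈ Y) (hyq : y ≠ q) (hd : dist y q ≤ 3 / 2 * a') :
    ∃ v ∈ P, f v = y ∧ ‖(y - q) - a' • A v‖ ≤ ε * a' := by
  obtain ⟨v, hv, hfy⟩ := hc y hy hyq hd
  refine ⟨v, hv, hfy, ?_⟩
  have h := (hm v hv).2
  rwa [hfy, dist_eq_norm, ← sub_sub] at h

/-! ## §2 Norms of matched offsets -/

/-- a matched offset has length `a' ‖v‖` up to `ε a'`. -/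
theorem abs_norm_sub_le (ha' : 0 ≤ a') {x v : EuclideanSpace ℝ (Fin 3)} (h : ‖x - a' • A v‖ ≤ ε * a') :
    |‖x‖ - a' * ‖v‖| ≤ ε * a' := by
  have h1 : ‖a' • A v‖ = a' * ‖v‖ := by rw [norm_smul, LinearIsometry.norm_map, Real.norm_of_nonneg ha']
  rw [← h1]
  exact (abs_norm_sub_norm_le x (a' • A v)).trans h

/-- table vectors have norm `1` or `√2`. -/
theorem norm_eq_one_or_sqrt_two (hP : P = fccTwoShellPattern ∨ P = hcpTwoShellPattern)
    {v : EuclideanSpace ℝ (Fin 3)} (hv : v ∈ P) : ‖v‖ = 1 ∨ ‖v‖ = Real.sqrt 2 := by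
  rcases hP with rfl | rfl
  · exact norm_of_mem_fccTwoShellPattern hv
  · exact norm_of_mem_hcpTwoShellPattern hv

/-- FIRST SHELL OF SHORT OFFSETS: with `a' ≥ 9/10` and `ε = 1/16`, an offset of length `≤ 17/16` is matched to a
first-shell vector (`a' (√2 − 1/16) > 1.21 > 17/16`). -/
theorem norm_eq_one_of_short (hP : P = fccTwoShellPattern ∨ P = hcpTwoShellPattern) (ha' : 9 / 10 ≤ a')
    {x v : EuclideanSpace ℝ (Fin 3)} (hv : v ∈ P) (h : ‖x - a' • A v‖ ≤ 1 / 16 * a') (hx : ‖x‖ ≤ 17 / 16) :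
    ‖v‖ = 1 := by
  rcases norm_eq_one_or_sqrt_two hP hv with h1 | h2
  · exact h1
  · exfalso
    have hb := abs_norm_sub_le (by linarith) h
    rw [h2] at hb
    have hs : (141 / 100 : ℝ) ≤ Real.sqrt 2 := by
      rw [show (141 / 100 : ℝ) = Real.sqrt ((141 / 100) ^ 2) by rw [Real.sqrt_sq (by norm_num)]]
      exact Real.sqrt_le_sqrt (by norm_num)
    have := (abs_le.mp hb).1
    nlinarith

/-! ## §3 Antipodal offsets -/

/-- offsets `x, x'` with `x + x' = 0`, matched to `v, v'`, have `‖v + v'‖ ≤ 2ε`. -/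
theorem norm_add_le_of_antipodal (ha' : 0 < a') {x x' v v' : EuclideanSpace ℝ (Fin 3)}
    (hx : ‖x - a' • A v‖ ≤ ε * a') (hx' : ‖x' - a' • A v'‖ ≤ ε * a') (h0 : x + x' = 0) : ‖v + v'‖ ≤ 2 * ε := by
  have hxx : x' = -x := eq_neg_of_add_eq_zero_right h0
  have h1 : a' • A (v + v') = (a' • A v - x) + (a' • A v' - x') := by
    rw [map_add, smul_add, hxx]; abel
  have h2 : ‖a' • A (v + v')‖ ≤ ε * a' + ε * a' := by
    rw [h1]
    exact (norm_add_le _ _).trans (add_le_add (by rwa [norm_sub_rev]) (by rwa [norm_sub_rev]))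
  rw [norm_smul, LinearIsometry.norm_map, Real.norm_of_nonneg ha'.le] at h2
  nlinarith

/-- ★ EXACT ANTIPODES: for `ε < 1/4`, offsets `x, −x` are matched to `v, −v`. -/
theorem eq_neg_of_antipodal (hP : P = fccTwoShellPattern ∨ P = hcpTwoShellPattern) (ha' : 0 < a') (hε : ε < 1 / 4)
    {x x' v v' : EuclideanSpace ℝ (Fin 3)} (hv : v ∈ P) (hv' : v' ∈ P)
    (hx : ‖x - a' • A v‖ ≤ ε * a') (hx' : ‖x' - a' • A v'‖ ≤ ε * a') (h0 : x + x' = 0) : v' = -v := by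
  have h1 := norm_add_le_of_antipodal ha' hx hx' h0
  have h2 : ‖v + v'‖ < 1 / 2 := by linarith
  exact eq_neg_of_add_eq_zero_right (add_eq_zero_of_norm_add_lt_half hP hv hv' h2)

/-! ## §4 Inner products of matched offsets -/

/-- `|⟪x, x'⟫ − a'² ⟪v, v'⟫| ≤ ε a' · a'‖v'‖ + ε a' · a'‖v‖ + (ε a')²`. -/
theorem abs_inner_sub_le (ha' : 0 ≤ a') {x x' v v' : EuclideanSpace ℝ (Fin 3)}
    (hx : ‖x - a' • A v‖ ≤ ε * a') (hx' : ‖x' - a' • A v'‖ ≤ ε * a') :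
    |⟪x, x'⟫ - a' ^ 2 * ⟪v, v'⟫| ≤ ε * a' * (a' * ‖v'‖) + ε * a' * (a' * ‖v‖) + (ε * a') ^ 2 := by
  have hAv : ‖a' • A v‖ = a' * ‖v‖ := by rw [norm_smul, LinearIsometry.norm_map, Real.norm_of_nonneg ha']
  have hAv' : ‖a' • A v'‖ = a' * ‖v'‖ := by rw [norm_smul, LinearIsometry.norm_map, Real.norm_of_nonneg ha']
  have hsplit : ⟪x, x'⟫ - a' ^ 2 * ⟪v, v'⟫ =
      ⟪x - a' • A v, a' • A v'⟫ + ⟪a' • A v, x' - a' • A v'⟫ + ⟪x - a' • A v, x' - a' • A v'⟫ := by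
    have hvv : ⟪a' • A v, a' • A v'⟫ = a' ^ 2 * ⟪v, v'⟫ := by
      rw [inner_smul_left, inner_smul_right, LinearIsometry.inner_map_map]; simp; ring
    rw [inner_sub_left, inner_sub_right, inner_sub_left, inner_sub_right, inner_sub_right, hvv]; ring
  rw [hsplit]
  have h1 : |⟪x - a' • A v, a' • A v'⟫| ≤ ε * a' * (a' * ‖v'‖) := by
    rw [← hAv']; exact (abs_real_inner_le_norm _ _).trans (mul_le_mul_of_nonneg_right hx (norm_nonneg _))
  have h2 : |⟪a' • A v, x' - a' • A v'⟫| ≤ ε * a' * (a' * ‖v‖) := by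
    rw [← hAv, mul_comm]; exact (abs_real_inner_le_norm _ _).trans (mul_le_mul_of_nonneg_left hx' (norm_nonneg _))
  have h3 : |⟪x - a' • A v, x' - a' • A v'⟫| ≤ (ε * a') ^ 2 := by
    rw [sq]; exact (abs_real_inner_le_norm _ _).trans (mul_le_mul hx hx' (norm_nonneg _) ((norm_nonneg _).trans hx))
  exact (abs_add_three _ _ _).trans (by linarith)

/-- first-shell matches at `ε = 1/16`: `|⟪x, x'⟫ − a'² ⟪v, v'⟫| ≤ (33/256) a'²`. -/
theorem abs_inner_sub_le_unit (ha' : 0 ≤ a') {x x' v v' : EuclideanSpace ℝ (Fin 3)} (hv1 : ‖v‖ = 1) (hv1' : ‖v'‖ = 1)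
    (hx : ‖x - a' • A v‖ ≤ 1 / 16 * a') (hx' : ‖x' - a' • A v'‖ ≤ 1 / 16 * a') :
    |⟪x, x'⟫ - a' ^ 2 * ⟪v, v'⟫| ≤ 33 / 256 * a' ^ 2 := by
  have h := abs_inner_sub_le ha' hx hx'
  rw [hv1, hv1'] at h
  nlinarith

/-! ## §4b Local separation and scale comparison -/

/-- either two-shell pattern is `1`-separated. -/
theorem one_le_dist_of_mem_twoShellPattern (hP : P = fccTwoShellPattern ∨ P = hcpTwoShellPattern)
    {x y : EuclideanSpace ℝ (Fin 3)} (hx : x ∈ P) (hy : y ∈ P) (hxy : x ≠ y) : 1 ≤ dist x y := by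
  rcases hP with rfl | rfl
  · exact one_le_dist_of_mem_fccTwoShellPattern hx hy hxy
  · exact one_le_dist_of_mem_hcpTwoShellPattern hx hy hxy

/-- a matched offset is at least `(1 − ε) a'` long (table vectors have norm `≥ 1`). -/
theorem le_norm_of_match (hP : P = fccTwoShellPattern ∨ P = hcpTwoShellPattern) (ha' : 0 ≤ a')
    {x v : EuclideanSpace ℝ (Fin 3)} (hv : v ∈ P) (h : ‖x - a' • A v‖ ≤ ε * a') : (1 - ε) * a' ≤ ‖x‖ := by
  have hb := abs_norm_sub_le ha' h
  have h1 : 1 ≤ ‖v‖ := by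
    rcases norm_eq_one_or_sqrt_two hP hv with h1 | h2
    · rw [h1]
    · rw [h2]; exact Real.one_le_sqrt.mpr (by norm_num)
  have := (abs_le.mp hb).1
  nlinarith

/-- ★ LOCAL SEPARATION.  Two atoms `y, y' ≠ q` of `Y` within `3a'/2` of `q` at distance `< (1 − 2ε) a'` are equal:
their table vectors are then `< 1` apart, hence equal, and `f` is a function. -/
theorem eq_of_near (hP : P = fccTwoShellPattern ∨ P = hcpTwoShellPattern)
    (hm : ∀ v ∈ P, f v ∈ Y ∧ dist (f v) (q + a' • A v) ≤ ε * a')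
    (hc : ∀ y ∈ Y, y ≠ q → dist y q ≤ 3 / 2 * a' → ∃ v ∈ P, f v = y) (ha' : 0 < a')
    {y y' : EuclideanSpace ℝ (Fin 3)} (hy : y ∈ Y) (hy' : y' ∈ Y) (hyq : y ≠ q) (hy'q : y' ≠ q)
    (hd : dist y q ≤ 3 / 2 * a') (hd' : dist y' q ≤ 3 / 2 * a') (hnear : ‖y - y'‖ < (1 - 2 * ε) * a') : y = y' := by
  obtain ⟨v, hv, hfv, hxv⟩ := exists_match hm hc hy hyq hd
  obtain ⟨v', hv', hfv', hxv'⟩ := exists_match hm hc hy' hy'q hd'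
  by_cases hvv : v = v'
  · rw [← hfv, ← hfv', hvv]
  · exfalso
    have h1 := one_le_dist_of_mem_twoShellPattern hP hv hv' hvv
    rw [dist_eq_norm] at h1
    have h2 : a' • A (v - v') = ((y - y') - ((y - q) - a' • A v)) + ((y' - q) - a' • A v') := by
      rw [map_sub, smul_sub]; abel
    have h3 : ‖a' • A (v - v')‖ ≤ ‖y - y'‖ + ε * a' + ε * a' := by
      rw [h2]
      refine (norm_add_le _ _).trans (add_le_add ((norm_sub_le _ _).trans (add_le_add le_rfl hxv)) hxv')
    rw [norm_smul, LinearIsometry.norm_map, Real.norm_of_nonneg ha'.le] at h3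
    nlinarith

/-- two scales that both fit one length `r` to relative accuracy `1/16` are comparable: `a₂ ≤ (17/15) a₁`. -/
theorem scale_le_of_common_length {r a₁ a₂ : ℝ} (h₁ : |r - a₁| ≤ 1 / 16 * a₁) (h₂ : |r - a₂| ≤ 1 / 16 * a₂) :
    a₂ ≤ 17 / 15 * a₁ := by
  have := (abs_le.mp h₁).2; have := (abs_le.mp h₂).1; linarith

/-! ## §5 Periods of a layered set at a clean atom -/

/-- ★ PERIOD MATCH (`ε = 1/16`, `a' ≥ 9/10`): if `q + t, q − t ∈ Y` with `0 < ‖t‖ ≤ 17/16`, then `t` is matched to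
a FIRST-SHELL table vector `p` whose antipode `−p` is also in the table and is matched to `−t`. -/
theorem period_match (hP : P = fccTwoShellPattern ∨ P = hcpTwoShellPattern)
    (hm : ∀ v ∈ P, f v ∈ Y ∧ dist (f v) (q + a' • A v) ≤ 1 / 16 * a')
    (hc : ∀ y ∈ Y, y ≠ q → dist y q ≤ 3 / 2 * a' → ∃ v ∈ P, f v = y) (ha' : 9 / 10 ≤ a')
    {t : EuclideanSpace ℝ (Fin 3)} (ht : q + t ∈ Y) (ht' : q - t ∈ Y) (ht0 : t ≠ 0) (htn : ‖t‖ ≤ 17 / 16) :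
    ∃ p ∈ P, ‖p‖ = 1 ∧ -p ∈ P ∧ f p = q + t ∧ f (-p) = q - t ∧ ‖t - a' • A p‖ ≤ 1 / 16 * a' := by
  have hd : dist (q + t) q ≤ 3 / 2 * a' := by rw [dist_eq_norm, add_sub_cancel_left]; linarith
  have hd' : dist (q - t) q ≤ 3 / 2 * a' := by rw [dist_eq_norm, sub_sub_cancel_left, norm_neg]; linarith
  have hne : q + t ≠ q := fun h => ht0 (by simpa using h)
  have hne' : q - t ≠ q := fun h => ht0 (by simpa using h)
  obtain ⟨p, hp, hfp, hxp⟩ := exists_match hm hc ht hne hd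
  obtain ⟨p', hp', hfp', hxp'⟩ := exists_match hm hc ht' hne' hd'
  rw [add_sub_cancel_left] at hxp
  rw [sub_sub_cancel_left] at hxp'
  have ha0 : 0 < a' := by linarith
  have hpp : p' = -p := eq_neg_of_antipodal hP ha0 (by norm_num) hp hp' hxp hxp' (add_neg_cancel t)
  subst hpp
  exact ⟨p, hp, norm_eq_one_of_short hP ha' hp hxp htn, hp', hfp, hfp', hxp⟩

/-- the table vectors matched to two periods `a ≠ ±b` are distinct and non-antipodal. -/
theorem periods_distinct {a b p₁ p₂ : EuclideanSpace ℝ (Fin 3)} (hf1 : f p₁ = q + a) (hf2 : f p₂ = q + b)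
    (hf1' : f (-p₁) = q - a) (hab : a ≠ b) (hab' : a + b ≠ 0) : p₁ ≠ p₂ ∧ p₁ + p₂ ≠ 0 := by
  refine ⟨fun h => hab ?_, fun h => hab' ?_⟩
  · have := hf2; rw [← h, hf1] at this; simpa using this
  · have h2 : p₂ = -p₁ := eq_neg_of_add_eq_zero_right h
    have := hf2; rw [h2, hf1'] at this
    have h3 : b = -a := by
      have h4 : q + b = q - a := this.symm
      have h5 := congrArg (fun z => z - q) h4
      simpa [sub_eq_add_neg] using h5
    rw [h3, add_neg_cancel]

/-- ★★ PERIODS AT A CLEAN ATOM — TYPE T | S.  At an atom `q` of `Y` carrying the clean-environment data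
`(a', A, P, f)` (`ε = 1/16`, `a' ≥ 9/10`), if `q ± a, q ± b ∈ Y` for two SHORT (`≤ 17/16`) vectors `a ≠ ±b`,
`a, b ≠ 0`, then `a, b` are matched to first-shell table vectors `p₁ ≠ ±p₂` with antipodes in the table,
`|‖a‖ − a'|, |‖b‖ − a'| ≤ a'/16`, and EITHER `⟪p₁,p₂⟫ = ±1/2` (T) OR `⟪p₁,p₂⟫ = 0 ∧ P = fcc` (S), with
`|⟪a,b⟫ − a'² ⟪p₁,p₂⟫| ≤ (33/256) a'²`. -/
theorem periods_type (hP : P = fccTwoShellPattern ∨ P = hcpTwoShellPattern)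
    (hm : ∀ v ∈ P, f v ∈ Y ∧ dist (f v) (q + a' • A v) ≤ 1 / 16 * a')
    (hc : ∀ y ∈ Y, y ≠ q → dist y q ≤ 3 / 2 * a' → ∃ v ∈ P, f v = y) (ha' : 9 / 10 ≤ a')
    {a b : EuclideanSpace ℝ (Fin 3)} (hqa : q + a ∈ Y) (hqa' : q - a ∈ Y) (hqb : q + b ∈ Y) (hqb' : q - b ∈ Y)
    (ha0 : a ≠ 0) (hb0 : b ≠ 0) (hab : a ≠ b) (hab' : a + b ≠ 0) (han : ‖a‖ ≤ 17 / 16) (hbn : ‖b‖ ≤ 17 / 16) :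
    ∃ p₁ ∈ P, ∃ p₂ ∈ P, ‖p₁‖ = 1 ∧ ‖p₂‖ = 1 ∧ -p₁ ∈ P ∧ -p₂ ∈ P ∧ p₁ ≠ p₂ ∧ p₁ + p₂ ≠ 0 ∧
      f p₁ = q + a ∧ f (-p₁) = q - a ∧ f p₂ = q + b ∧ f (-p₂) = q - b ∧
      ‖a - a' • A p₁‖ ≤ 1 / 16 * a' ∧ ‖b - a' • A p₂‖ ≤ 1 / 16 * a' ∧
      |‖a‖ - a'| ≤ 1 / 16 * a' ∧ |‖b‖ - a'| ≤ 1 / 16 * a' ∧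
      ((⟪p₁, p₂⟫ = 1 / 2 ∨ ⟪p₁, p₂⟫ = -1 / 2) ∨ (⟪p₁, p₂⟫ = 0 ∧ P = fccTwoShellPattern)) ∧
      |⟪a, b⟫ - a' ^ 2 * ⟪p₁, p₂⟫| ≤ 33 / 256 * a' ^ 2 := by
  obtain ⟨p₁, hp₁, h1n, h1m, hf1, hf1', hx1⟩ := period_match hP hm hc ha' hqa hqa' ha0 han
  obtain ⟨p₂, hp₂, h2n, h2m, hf2, hf2', hx2⟩ := period_match hP hm hc ha' hqb hqb' hb0 hbn
  obtain ⟨hne, hna⟩ := periods_distinct hf1 hf2 hf1' hab hab'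
  have h0 : 0 ≤ a' := by linarith
  have hna' := abs_norm_sub_le h0 hx1
  have hnb' := abs_norm_sub_le h0 hx2
  rw [h1n, mul_one] at hna'
  rw [h2n, mul_one] at hnb'
  exact ⟨p₁, hp₁, p₂, hp₂, h1n, h2n, h1m, h2m, hne, hna, hf1, hf1', hf2, hf2', hx1, hx2, hna', hnb',
    inner_first_shell_pair hP hp₁ hp₂ h1n h2n h1m h2m hne hna, abs_inner_sub_le_unit h0 h1n h2n hx1 hx2⟩

end Summit.AtomisticToContinuum.Crystallization.Theorems.ChartedPlanarOrderCleanEnvironment
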